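import Summits.Ventures.Crystal3D.Theorems.StickyWulffConstantStackingLiminfRefinedArith
import HarnessLib

/-!
# The OPTIMAL calibration for the word-uniform layer-profile ladder toward `StackingLiminf`
# (stmt-Ventures-19145) — DEFINITIONS D1–D5 (cf-p2 R20, `BLUEPRINT-profileDual.md` §3)

Route `StickyWulffConstant` of the venture `Summits/Ventures/Crystal3D` (cell `crystal3d-full`).
This file holds, verbatim from the planner's Lean companion `HOME/cf-p2/OptimalCalibrationSketch.lean`
(cf-p2 g10, evidence #17 on stmt-Ventures-19145), the dual functions of the optimal calibration of the
layer-profile LP (inputs `layerProfile` p462465 with `(c, δ) = (1, 0)`, `layerProfileSharp` p464674 with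
`(c, δ) = (√2, 1/2)`), so that the structural lemmas, the value estimate and the rung assembly
(separate `Theorems/` files) can name them:
* `s x = √(12 − 3/x)`; D1 `omega c δ M = c + s M − δ/√M`; D2 `phi c δ M m = ω_M √m/√M − s m` and the
  weight `thetaW c δ M m = max(φ(m),0)/c` (`0` at `m = 0`); D3 `Psi c δ M n = Σ_{m=1}^{n} θ_w(m)`;
  D4 `Psi2 c δ M n = ω_M n/√M − √(12n − 3)` (`0` at `n = 0`); D5 `G c δ M n = 3n/2 − Ψ(n) − Ψ₂(n)/2`.
Certified background (not used here): R20's exact ceiling `(c*_c)³ = 243 + 54√3·c + 45c²/4` of the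
ladder (kit j262960/j263200/j262988).  WHAT THIS IS NOT: no theorem about the crux; rung F-C1 not moved.
-/

noncomputable section

namespace Summit.Ventures.Crystal3D.Theorems.OptimalCalibration

open Finset

/-! ### D1–D5 — the optimal dual functions (parameters `c δ : ℝ`, top layer size `M : ℕ`) -/

/-- `s(x) = √(12 − 3/x)` (so that `√x · s(x) = √(12x − 3)` for `x > 0`). -/
def s (x : ℝ) : ℝ := Real.sqrt (12 - 3 / x)

/-- D1: `ω_M = c + s(M) − δ/√M` (tight at `n = M`; `ω_M ↑ β_c = c + 2√3`). -/
def omega (c δ : ℝ) (M : ℕ) : ℝ := c + s M - δ / Real.sqrt M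

/-- D2: `φ(m) = ω_M √m/√M − s(m)`. -/
def phi (c δ : ℝ) (M : ℕ) (m : ℕ) : ℝ := omega c δ M * Real.sqrt m / Real.sqrt M - s m

/-- D2: the weight `θ_w(m) = max(φ(m), 0)/c`, `θ_w(0) = 0`. -/
def thetaW (c δ : ℝ) (M : ℕ) (m : ℕ) : ℝ := if m = 0 then 0 else max (phi c δ M m) 0 / c

/-- D3: `Ψ(n) = Σ_{m=1}^{n} θ_w(m)`. -/
def Psi (c δ : ℝ) (M : ℕ) (n : ℕ) : ℝ := ∑ m ∈ range n, thetaW c δ M (m + 1)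

/-- D4: `Ψ₂(n) = ω_M n/√M − √(12n − 3)` (`n ≥ 1`), `Ψ₂(0) = 0`. -/
def Psi2 (c δ : ℝ) (M : ℕ) (n : ℕ) : ℝ :=
  if n = 0 then 0 else omega c δ M * n / Real.sqrt M - Real.sqrt (12 * n - 3)

/-- D5: `G(n) = 3n/2 − Ψ(n) − Ψ₂(n)/2`. -/
def G (c δ : ℝ) (M : ℕ) (n : ℕ) : ℝ := 3 / 2 * n - Psi c δ M n - Psi2 c δ M n / 2


/-- Unfolding `s`. -/
theorem s_def (x : ℝ) : s x = Real.sqrt (12 - 3 / x) := rfl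

/-- Unfolding `omega`. -/
theorem omega_def (c δ : ℝ) (M : ℕ) : omega c δ M = c + s M - δ / Real.sqrt M := rfl

/-- Unfolding `phi`. -/
theorem phi_def (c δ : ℝ) (M m : ℕ) :
    phi c δ M m = omega c δ M * Real.sqrt m / Real.sqrt M - s m := rfl

/-- Unfolding `thetaW`. -/
theorem thetaW_def (c δ : ℝ) (M m : ℕ) :
    thetaW c δ M m = if m = 0 then 0 else max (phi c δ M m) 0 / c := rfl

/-- Unfolding `Psi`. -/
theorem Psi_def (c δ : ℝ) (M n : ℕ) :
    Psi c δ M n = ∑ m ∈ range n, thetaW c δ M (m + 1) := rfl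

/-- Unfolding `Psi2`. -/
theorem Psi2_def (c δ : ℝ) (M n : ℕ) :
    Psi2 c δ M n = if n = 0 then 0 else omega c δ M * n / Real.sqrt M - Real.sqrt (12 * n - 3) := rfl

/-- Unfolding `G`. -/
theorem G_def (c δ : ℝ) (M n : ℕ) : G c δ M n = 3 / 2 * n - Psi c δ M n - Psi2 c δ M n / 2 := rfl

end Summit.Ventures.Crystal3D.Theorems.OptimalCalibration

end
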